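import Literature.RepresentationTheory.Semisimple.BrauerNesbitt
import Literature.RepresentationTheory.Semisimple.Semisimplification
import Literature.RepresentationTheory.Semisimple.BurnsideMatrixSpan
import Literature.RepresentationTheory.Semisimple.SubrepresentationEquiv
import Literature.RepresentationTheory.Semisimple.FinTwoSemisimplification
import Mathlib.LinearAlgebra.Matrix.Basis
import Mathlib.LinearAlgebra.Charpoly.ToMatrix
import HarnessLib

/-!
# Residual block-triangular form with irreducible diagonal blocks — auxiliary lemmas
(crux `PhantomRMYoshida.ResiduallyYoshidaLifting`, item stmt-Langlands-13639, line
`endoscopic-crossing-euler`; helpers for the stub `stub_residualTriangular` of the sibling file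
`PhantomRMYoshidaResiduallyYoshidaLiftingResidualTriangular.lean` — pure representation theory of an
abstract group `G` over fields of any characteristic)

Fix `σ, σ' : G → GL₂(K)` irreducible on `K²`.

* `eq_zero_of_forall_smul_of_charpoly` — **no stable line in `σ ⊕ σ'`**: a matrix representation
  `ψ : G → GL_n(K)`, semisimple on `Kⁿ`, with `det(X - ψ g) = det(X - σ g) det(X - σ' g)` has no common
  eigenvector: by the Brauer–Nesbitt theorem over an arbitrary field (Bourbaki, *Algèbre* VIII § 20
  n° 6, Thm. 2, Cor. 1; tree `Representation.nonempty_equiv_of_charpoly_eq`) `Kⁿ ≃ σ ⊕ σ'` (Mathlib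
  `Representation.prod`, `LinearMap.charpoly_prodMap`), and both components of a common eigenvector of
  `σ ⊕ σ'` span stable subspaces of dimension `≤ 1` of irreducible planes (`eq_zero_of_forall_smul_fin_two`).
* `false_of_charpoly_fin_one_mul` (registered in universe `0` as `stub_residualNoCharacter`) — hence no
  `χ : G → GL₁(K)`, `D : G → GL₃(K)` have `det(X - χ g) det(X - D g) = det(X - σ g) det(X - σ' g)`:
  semisimplify both (`exists_semisimplification`); the first coordinate line of `χ^ss ⊕ D^ss`
  (`exists_blockDiag_hom`, `isSemisimpleRepresentation_of_blockDiag`) is stable.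
* `isIrreducible_of_charpoly_mul` — so a rank-two `a` with `det(X - a g) det(X - d g) = det(X - σ g) det(X - σ' g)`
  for some rank-two `d` is irreducible (else dévissage `exists_blocks_of_subrepresentation` of `a` splits
  off a character).
* `exists_conj_eq_fromBlocks` — **dévissage with an explicit change of basis** (Curtis–Reiner, *Methods*
  I, §16B; the computation of `exists_blocks_of_subrepresentation`, which only records the diagonal
  blocks): for a subrepresentation `W ≤ Kⁿ` of `ψ : G → GL_n(K)`, a complement `C`, bases of `W`, `C` and
  `e : Fin m ⊕ Fin p ≃ Fin n`, the matrix `w` of the adapted basis has `w⁻¹ ψ(g) w = (A g, B g; 0, D g)`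
  with `A`, `D` homomorphisms into `GL_m`, `GL_p` (Mathlib
  `basis_toMatrix_mul_linearMap_toMatrix_mul_basis_toMatrix`); `charpoly_eq_of_conj_eq_fromBlocks` reads
  off `det(X - ψ g) = det(X - A g) det(X - D g)`.
* glue: `charpoly_glRep_apply`, `exists_ne_bot_ne_top_of_not_isIrreducible`, `not_isIrreducible_prod`.

References: N. Bourbaki, *Algèbre, Chapitre VIII*, 2ᵉ éd. (2012), § 20 n° 6 [BourbakiAlgebreVIII2012];
C. W. Curtis, I. Reiner, *Methods of Representation Theory* I (1981), §16B.
-/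

noncomputable section

set_option linter.dupNamespace false -- project-wide option (lakefile weak.linter.dupNamespace); `Summit.Langlands.Langlands` is the mandated namespace

open scoped MatrixGroups
open Matrix Module Literature.RepresentationTheory.Semisimple

namespace Summit.Langlands.Langlands.Cruxes.ResiduallyYoshidaLifting.EndoscopicCrossingEuler

section Helpers

variable {K : Type*} [Field K] {G : Type*} [Group G]

/-- `det(X - g|Kⁿ) = det(X - φ g)` for the representation on `Kⁿ` through `φ : G → GL_n(K)`. [folklore] -/
theorem charpoly_glRep_apply {n : ℕ} (φ : G →* GL (Fin n) K) (g : G) :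
    (((Representation.ofDistribMulAction K (GL (Fin n) K) (Fin n → K)).comp φ) g).charpoly =
      ((φ g : GL (Fin n) K) : Matrix (Fin n) (Fin n) K).charpoly := by
  have h : (((Representation.ofDistribMulAction K (GL (Fin n) K) (Fin n → K)).comp φ) g :
      (Fin n → K) →ₗ[K] (Fin n → K)) =
      Matrix.toLin' ((φ g : GL (Fin n) K) : Matrix (Fin n) (Fin n) K) :=
    LinearMap.ext fun v ↦ by rw [Matrix.toLin'_apply]; rfl
  rw [h, Matrix.charpoly_toLin']

/-- A reducible representation on a non-zero space has a proper non-zero subrepresentation. [folklore] -/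
theorem exists_ne_bot_ne_top_of_not_isIrreducible {V : Type*} [AddCommGroup V] [Module K V]
    [Nontrivial V] (ρ : Representation K G V) (h : ¬ ρ.IsIrreducible) :
    ∃ W : Subrepresentation ρ, W ≠ ⊥ ∧ W ≠ ⊤ := by
  by_contra hcon
  push Not at hcon
  have hbt : (⊥ : Subrepresentation ρ) ≠ ⊤ := fun hbt ↦ by
    have h' := congrArg Subrepresentation.toSubmodule hbt
    change (⊥ : Submodule K V) = ⊤ at h'
    exact bot_ne_top h'
  haveI : Nontrivial (Subrepresentation ρ) := ⟨⟨⊥, ⊤, hbt⟩⟩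
  exact h ⟨fun W ↦ or_iff_not_imp_left.mpr (hcon W)⟩

/-- A direct sum of two non-zero representations is reducible (`ker snd` is proper, non-zero). [folklore] -/
theorem not_isIrreducible_prod {V W : Type*} [AddCommGroup V] [Module K V] [AddCommGroup W]
    [Module K W] [Nontrivial V] [Nontrivial W] (ρ : Representation K G V)
    (τ : Representation K G W) : ¬ (ρ.prod τ).IsIrreducible := by
  intro h
  obtain ⟨v, hv⟩ := exists_ne (0 : V)
  obtain ⟨w, hw⟩ := exists_ne (0 : W)
  haveI := h
  rcases eq_bot_or_eq_top (Representation.IntertwiningMap.snd K ρ τ).ker with h0 | h1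
  · have hmem : ((v, 0) : V × W) ∈ (Representation.IntertwiningMap.snd K ρ τ).ker := by
      rw [Representation.IntertwiningMap.mem_ker, Representation.IntertwiningMap.snd_apply]
    rw [h0] at hmem
    change ((v, 0) : V × W) ∈ (⊥ : Submodule K (V × W)) at hmem
    rw [Submodule.mem_bot, Prod.mk_eq_zero] at hmem
    exact hv hmem.1
  · have hmem : ((0, w) : V × W) ∈ (Representation.IntertwiningMap.snd K ρ τ).ker := by
      rw [h1]
      change ((0, w) : V × W) ∈ (⊤ : Submodule K (V × W))
      exact Submodule.mem_top
    rw [Representation.IntertwiningMap.mem_ker, Representation.IntertwiningMap.snd_apply] at hmem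
    exact hw hmem

/-- A common eigenvector of an irreducible two-dimensional matrix representation is zero. [folklore] -/
theorem eq_zero_of_forall_smul_fin_two (σ : G →* GL (Fin 2) K)
    (hσ : Representation.IsIrreducible
      ((Representation.ofDistribMulAction K (GL (Fin 2) K) (Fin 2 → K)).comp σ))
    {v : Fin 2 → K}
    (hv : ∀ g, ∃ c : K,
      ((Representation.ofDistribMulAction K (GL (Fin 2) K) (Fin 2 → K)).comp σ) g v = c • v) :
    v = 0 := by
  by_contra hv0
  set R := (Representation.ofDistribMulAction K (GL (Fin 2) K) (Fin 2 → K)).comp σ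
  let L : Subrepresentation R := ⟨K ∙ v, fun g w hw ↦ by
    rw [Submodule.mem_span_singleton] at hw ⊢
    obtain ⟨a, rfl⟩ := hw
    obtain ⟨c, hc⟩ := hv g
    exact ⟨a * c, by rw [map_smul, hc, smul_smul]⟩⟩
  haveI := hσ
  rcases eq_bot_or_eq_top L with h | h
  · have hmem : v ∈ L.toSubmodule := Submodule.mem_span_singleton_self v
    rw [h] at hmem
    change v ∈ (⊥ : Submodule K (Fin 2 → K)) at hmem
    exact hv0 ((Submodule.mem_bot K).mp hmem)
  · have hrank : finrank K L.toSubmodule = 1 := finrank_span_singleton hv0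
    rw [h] at hrank
    change finrank K (⊤ : Submodule K (Fin 2 → K)) = 1 at hrank
    rw [finrank_top, finrank_fin_fun] at hrank
    exact absurd hrank (by norm_num)

/-! ### No stable line in `σ ⊕ σ'` -/

/-- **No stable line.**  If `ψ : G → GL_n(K)` is semisimple on `Kⁿ` with
`det(X - ψ g) = det(X - σ g) det(X - σ' g)` for `σ, σ'` irreducible of rank `2`, then `ψ` has no
common eigenvector: by the Brauer–Nesbitt theorem over an arbitrary field `Kⁿ ≃ σ ⊕ σ'`
(`Representation.nonempty_equiv_of_charpoly_eq`), and a common eigenvector of `σ ⊕ σ'` has both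
components zero. [cite: BourbakiAlgebreVIII2012, VIII §20 n°6 Thm 2 Cor 1] -/
theorem eq_zero_of_forall_smul_of_charpoly {σ σ' : G →* GL (Fin 2) K}
    (hσ : Representation.IsIrreducible
      ((Representation.ofDistribMulAction K (GL (Fin 2) K) (Fin 2 → K)).comp σ))
    (hσ' : Representation.IsIrreducible
      ((Representation.ofDistribMulAction K (GL (Fin 2) K) (Fin 2 → K)).comp σ'))
    {n : ℕ} (ψ : G →* GL (Fin n) K)
    (hss : Representation.IsSemisimpleRepresentation
      ((Representation.ofDistribMulAction K (GL (Fin n) K) (Fin n → K)).comp ψ))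
    (hcp : ∀ g, ((ψ g : GL (Fin n) K) : Matrix (Fin n) (Fin n) K).charpoly =
      ((σ g : GL (Fin 2) K) : Matrix (Fin 2) (Fin 2) K).charpoly *
        ((σ' g : GL (Fin 2) K) : Matrix (Fin 2) (Fin 2) K).charpoly)
    {u : Fin n → K}
    (hu : ∀ g, ∃ c : K,
      ((Representation.ofDistribMulAction K (GL (Fin n) K) (Fin n → K)).comp ψ) g u = c • u) :
    u = 0 := by
  set Rσ : Representation K G (Fin 2 → K) :=
    (Representation.ofDistribMulAction K (GL (Fin 2) K) (Fin 2 → K)).comp σ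
  set Rσ' : Representation K G (Fin 2 → K) :=
    (Representation.ofDistribMulAction K (GL (Fin 2) K) (Fin 2 → K)).comp σ'
  set R : Representation K G (Fin n → K) :=
    (Representation.ofDistribMulAction K (GL (Fin n) K) (Fin n → K)).comp ψ
  haveI := hss
  haveI : IsSimpleOrder (Subrepresentation Rσ) := hσ
  haveI : IsSimpleOrder (Subrepresentation Rσ') := hσ'
  have h : ∀ g, (R g).charpoly = ((Rσ.prod Rσ') g).charpoly := fun g ↦ by
    rw [show (Rσ.prod Rσ') g = (Rσ g).prodMap (Rσ' g) from rfl, LinearMap.charpoly_prodMap,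
      charpoly_glRep_apply, charpoly_glRep_apply, charpoly_glRep_apply, hcp]
  obtain ⟨e⟩ := Representation.nonempty_equiv_of_charpoly_eq R (Rσ.prod Rσ') h
  have he : ∀ g, (Rσ.prod Rσ') g (e u) = e (R g u) := fun g ↦
    (Representation.IntertwiningMap.isIntertwining R (Rσ.prod Rσ') e.toIntertwiningMap g u).symm
  have heig : ∀ g, ∃ c : K, (Rσ.prod Rσ') g (e u) = c • e u := fun g ↦ by
    obtain ⟨c, hc⟩ := hu g
    exact ⟨c, by rw [he, hc, map_smul]⟩
  have h1 : (e u).1 = 0 := eq_zero_of_forall_smul_fin_two σ hσ fun g ↦ by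
    obtain ⟨c, hc⟩ := heig g
    have h := congrArg Prod.fst hc
    rw [Representation.prod_apply_apply, Prod.smul_fst] at h
    exact ⟨c, h⟩
  have h2 : (e u).2 = 0 := eq_zero_of_forall_smul_fin_two σ' hσ' fun g ↦ by
    obtain ⟨c, hc⟩ := heig g
    have h := congrArg Prod.snd hc
    rw [Representation.prod_apply_apply, Prod.smul_snd] at h
    exact ⟨c, h⟩
  have heu : e u = 0 := Prod.ext h1 h2
  have := congrArg e.symm heu
  rwa [Representation.Equiv.symm_apply_apply, map_zero] at this

/-- **A character cannot be split off `σ ⊕ σ'`.**  There is no pair `χ : G → GL₁(K)`,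
`D : G → GL₃(K)` with `det(X - χ g) det(X - D g) = det(X - σ g) det(X - σ' g)` for all `g`:
semisimplifying both (`exists_semisimplification`), the first coordinate line of the block-diagonal
`χ^ss ⊕ D^ss` would be a stable line, excluded by `eq_zero_of_forall_smul_of_charpoly`. [folklore] -/
theorem false_of_charpoly_fin_one_mul {σ σ' : G →* GL (Fin 2) K}
    (hσ : Representation.IsIrreducible
      ((Representation.ofDistribMulAction K (GL (Fin 2) K) (Fin 2 → K)).comp σ))
    (hσ' : Representation.IsIrreducible
      ((Representation.ofDistribMulAction K (GL (Fin 2) K) (Fin 2 → K)).comp σ'))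
    (χ : G →* GL (Fin 1) K) (D : G →* GL (Fin 3) K)
    (h : ∀ g, ((χ g : GL (Fin 1) K) : Matrix (Fin 1) (Fin 1) K).charpoly *
      ((D g : GL (Fin 3) K) : Matrix (Fin 3) (Fin 3) K).charpoly =
      ((σ g : GL (Fin 2) K) : Matrix (Fin 2) (Fin 2) K).charpoly *
        ((σ' g : GL (Fin 2) K) : Matrix (Fin 2) (Fin 2) K).charpoly) : False := by
  classical
  obtain ⟨χ', hχ'ss, hχ'cp, -⟩ := exists_semisimplification χ
  obtain ⟨D', hD'ss, hD'cp, -⟩ := exists_semisimplification D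
  obtain ⟨ψ, hψ⟩ := exists_blockDiag_hom (k := K) (finSumFinEquiv : Fin 1 ⊕ Fin 3 ≃ Fin 4) χ' D'
  have hss := isSemisimpleRepresentation_of_blockDiag _ hψ hχ'ss hD'ss
  have hcp : ∀ g, ((ψ g : GL (Fin 4) K) : Matrix (Fin 4) (Fin 4) K).charpoly =
      ((σ g : GL (Fin 2) K) : Matrix (Fin 2) (Fin 2) K).charpoly *
        ((σ' g : GL (Fin 2) K) : Matrix (Fin 2) (Fin 2) K).charpoly := fun g ↦ by
    rw [hψ g, Matrix.charpoly_reindex, Matrix.charpoly_fromBlocks_zero₂₁, hχ'cp, hD'cp, h]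
  -- the first coordinate vector is a common eigenvector
  set j₀ : Fin 4 := (finSumFinEquiv : Fin 1 ⊕ Fin 3 ≃ Fin 4) (Sum.inl 0) with hj₀
  have hu : ∀ g, ∃ c : K,
      ((Representation.ofDistribMulAction K (GL (Fin 4) K) (Fin 4 → K)).comp ψ) g
        (Pi.single j₀ 1) = c • Pi.single j₀ 1 := fun g ↦ by
    refine ⟨((χ' g : GL (Fin 1) K) : Matrix (Fin 1) (Fin 1) K) 0 0, ?_⟩
    change ((ψ g : GL (Fin 4) K) : Matrix (Fin 4) (Fin 4) K) *ᵥ Pi.single j₀ 1 = _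
    rw [hψ g, Matrix.mulVec_single_one]
    ext i
    obtain ⟨x, rfl⟩ := (finSumFinEquiv : Fin 1 ⊕ Fin 3 ≃ Fin 4).surjective i
    rw [Matrix.col_apply, Matrix.reindex_apply, Matrix.submatrix_apply, Equiv.symm_apply_apply,
      hj₀, Equiv.symm_apply_apply, Pi.smul_apply, smul_eq_mul]
    rcases x with x | x
    · obtain rfl : x = 0 := Subsingleton.elim _ _
      rw [Matrix.fromBlocks_apply₁₁, Pi.single_eq_same, mul_one]
    · rw [Matrix.fromBlocks_apply₂₁, Matrix.zero_apply,
        Pi.single_eq_of_ne ((finSumFinEquiv : Fin 1 ⊕ Fin 3 ≃ Fin 4).injective.ne Sum.inr_ne_inl),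
        mul_zero]
  have h0 := eq_zero_of_forall_smul_of_charpoly hσ hσ' ψ hss hcp hu
  simpa using congr_fun h0 j₀

/-- **A rank-two diagonal block is irreducible.**  If `a, d : G → GL₂(K)` have
`det(X - a g) det(X - d g) = det(X - σ g) det(X - σ' g)` for all `g`, then `a` is irreducible on
`K²`: otherwise dévissage of `a` along a stable line (`exists_blocks_of_subrepresentation`) gives
characters `χ₁, χ₂` with `det(X - a g) = det(X - χ₁ g) det(X - χ₂ g)`, and `χ₁`, `χ₂ ⊕ d` are
excluded by `false_of_charpoly_fin_one_mul`. [folklore] -/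
theorem isIrreducible_of_charpoly_mul {σ σ' : G →* GL (Fin 2) K}
    (hσ : Representation.IsIrreducible
      ((Representation.ofDistribMulAction K (GL (Fin 2) K) (Fin 2 → K)).comp σ))
    (hσ' : Representation.IsIrreducible
      ((Representation.ofDistribMulAction K (GL (Fin 2) K) (Fin 2 → K)).comp σ'))
    (a d : G →* GL (Fin 2) K)
    (h : ∀ g, ((a g : GL (Fin 2) K) : Matrix (Fin 2) (Fin 2) K).charpoly *
      ((d g : GL (Fin 2) K) : Matrix (Fin 2) (Fin 2) K).charpoly =
      ((σ g : GL (Fin 2) K) : Matrix (Fin 2) (Fin 2) K).charpoly *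
        ((σ' g : GL (Fin 2) K) : Matrix (Fin 2) (Fin 2) K).charpoly) :
    Representation.IsIrreducible
      ((Representation.ofDistribMulAction K (GL (Fin 2) K) (Fin 2 → K)).comp a) := by
  by_contra hirr
  obtain ⟨W, hW0, hW1⟩ := exists_ne_bot_ne_top_of_not_isIrreducible _ hirr
  obtain ⟨m, p, hm, hp, e, A, D, hcp, -, -⟩ := exists_blocks_of_subrepresentation a W hW0 hW1
  have hmp : m + p = 2 := by simpa using Fintype.card_congr e
  obtain rfl : m = 1 := by omega
  obtain rfl : p = 1 := by omega
  obtain ⟨D₃, hD₃⟩ := exists_blockDiag_hom (k := K) (finSumFinEquiv : Fin 1 ⊕ Fin 2 ≃ Fin 3) D d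
  refine false_of_charpoly_fin_one_mul hσ hσ' A D₃ fun g ↦ ?_
  rw [hD₃ g, Matrix.charpoly_reindex, Matrix.charpoly_fromBlocks_zero₂₁, ← mul_assoc, ← hcp g, h g]

/-! ### Dévissage with an explicit change of basis -/

/-- `det(X - u) = det(X - A) det(X - D)` when `w⁻¹ u w = (A, B; 0, D)` (Mathlib `Matrix.charpoly_units_conj'`,
`Matrix.charpoly_fromBlocks_zero₂₁`). [folklore] -/
theorem charpoly_eq_of_conj_eq_fromBlocks {n m p : ℕ} (e : Fin m ⊕ Fin p ≃ Fin n)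
    {w u : GL (Fin n) K} {A : Matrix (Fin m) (Fin m) K} {B : Matrix (Fin m) (Fin p) K}
    {D : Matrix (Fin p) (Fin p) K}
    (h : ((w⁻¹ * u * w : GL (Fin n) K) : Matrix (Fin n) (Fin n) K) =
      Matrix.reindex e e (Matrix.fromBlocks A B 0 D)) :
    (u : Matrix (Fin n) (Fin n) K).charpoly = A.charpoly * D.charpoly := by
  rw [Units.val_mul, Units.val_mul, Matrix.coe_units_inv] at h
  rw [← Matrix.charpoly_units_conj' w (u : Matrix (Fin n) (Fin n) K), h, Matrix.charpoly_reindex,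
    Matrix.charpoly_fromBlocks_zero₂₁]

/-- **Dévissage with an explicit change of basis** (Curtis–Reiner, *Methods* I, §16B; the
computation of `Literature.RepresentationTheory.Semisimple.exists_blocks_of_subrepresentation`).
Let `W` be a subrepresentation of `Kⁿ` (through `ψ : G → GL_n(K)`), `C` a complement of `W`, `bW`,
`bC` bases of `W`, `C` indexed by `Fin m`, `Fin p`, and `e : Fin m ⊕ Fin p ≃ Fin n`.  The matrix
`w ∈ GL_n(K)` whose columns are the adapted basis conjugates `ψ` into block upper triangular form,
`w⁻¹ ψ(g) w = (A g, B g; 0, D g)` (blocks along `e`), with `A : G → GL_m(K)`, `D : G → GL_p(K)`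
homomorphisms. [folklore] -/
theorem exists_conj_eq_fromBlocks {n m p : ℕ} (ψ : G →* GL (Fin n) K)
    (W : Subrepresentation
      ((Representation.ofDistribMulAction K (GL (Fin n) K) (Fin n → K)).comp ψ))
    (C : Submodule K (Fin n → K)) (hWC : IsCompl W.toSubmodule C)
    (bW : Basis (Fin m) K W.toSubmodule) (bC : Basis (Fin p) K C) (e : Fin m ⊕ Fin p ≃ Fin n) :
    ∃ (w : GL (Fin n) K) (A : G →* GL (Fin m) K) (D : G →* GL (Fin p) K)
      (B : G → Matrix (Fin m) (Fin p) K), ∀ g,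
      ((w⁻¹ * ψ g * w : GL (Fin n) K) : Matrix (Fin n) (Fin n) K) =
        Matrix.reindex e e (Matrix.fromBlocks ((A g : GL (Fin m) K) : Matrix (Fin m) (Fin m) K)
          (B g) 0 ((D g : GL (Fin p) K) : Matrix (Fin p) (Fin p) K)) := by
  classical
  -- adapted from `Literature.RepresentationTheory.Semisimple.exists_blocks_of_subrepresentation`
  have hRlin : ∀ g,
      (((Representation.ofDistribMulAction K (GL (Fin n) K) (Fin n → K)).comp ψ) g :
        (Fin n → K) →ₗ[K] (Fin n → K)) =
      Matrix.toLin' ((ψ g : GL (Fin n) K) : Matrix (Fin n) (Fin n) K) := fun g ↦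
    LinearMap.ext fun v ↦ by rw [Matrix.toLin'_apply]; rfl
  -- an adapted basis `b`
  let f : (W.toSubmodule × C) ≃ₗ[K] (Fin n → K) := Submodule.prodEquivOfIsCompl W.toSubmodule C hWC
  let b : Basis (Fin m ⊕ Fin p) K (Fin n → K) := (bW.prod bC).map f
  have hrepr : ∀ w : Fin n → K, w ∈ W.toSubmodule → ∀ i : Fin p, b.repr w (Sum.inr i) = 0 := by
    intro w hw i
    have h1 : b.repr w = (bW.prod bC).repr (f.symm w) := by
      simp only [b, Module.Basis.map_repr, LinearEquiv.trans_apply]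
    have h2 : f.symm w = ((⟨w, hw⟩ : W.toSubmodule), 0) :=
      Submodule.prodEquivOfIsCompl_symm_apply_left (p := W.toSubmodule) (q := C) hWC
        (⟨w, hw⟩ : W.toSubmodule)
    rw [h1, h2, Module.Basis.prod_repr_inr]
    simp
  have hb_inl : ∀ j : Fin m, (b (Sum.inl j) : Fin n → K) ∈ W.toSubmodule := by
    intro j
    have : b (Sum.inl j) = f ((bW.prod bC) (Sum.inl j)) := by simp [b]
    rw [this, Submodule.coe_prodEquivOfIsCompl', Module.Basis.prod_apply_inl_fst,
      Module.Basis.prod_apply_inl_snd]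
    simp
  -- matrices in the adapted basis
  let M : G → Matrix (Fin m ⊕ Fin p) (Fin m ⊕ Fin p) K := fun g ↦
    LinearMap.toMatrix b b (((Representation.ofDistribMulAction K (GL (Fin n) K) (Fin n → K)).comp ψ) g)
  have hM_mul : ∀ g h, M (g * h) = M g * M h := fun g h ↦ by
    simp only [M, map_mul]
    exact LinearMap.toMatrix_mul b _ _
  have hM_one : M 1 = 1 := by
    simp only [M, map_one]
    exact LinearMap.toMatrix_one b
  have h21 : ∀ g, (M g).toBlocks₂₁ = 0 := by
    intro g
    ext i j
    change M g (Sum.inr i) (Sum.inl j) = 0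
    simp only [M, LinearMap.toMatrix_apply]
    exact hrepr _ (W.apply_mem_toSubmodule g (hb_inl j)) i
  -- the diagonal blocks are multiplicative
  let A₀ : G → Matrix (Fin m) (Fin m) K := fun g ↦ (M g).toBlocks₁₁
  let B₀ : G → Matrix (Fin m) (Fin p) K := fun g ↦ (M g).toBlocks₁₂
  let D₀ : G → Matrix (Fin p) (Fin p) K := fun g ↦ (M g).toBlocks₂₂
  have hblock : ∀ g, M g = Matrix.fromBlocks (A₀ g) (B₀ g) 0 (D₀ g) := fun g ↦ by
    conv_lhs => rw [← Matrix.fromBlocks_toBlocks (M g), h21 g]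
  have hmul : ∀ g h, A₀ (g * h) = A₀ g * A₀ h ∧ D₀ (g * h) = D₀ g * D₀ h := by
    intro g h
    have e1 := hM_mul g h
    rw [hblock, hblock, hblock, Matrix.fromBlocks_multiply] at e1
    obtain ⟨hA, -, -, hD⟩ := Matrix.fromBlocks_inj.mp e1
    refine ⟨?_, ?_⟩
    · rw [hA, Matrix.mul_zero, add_zero]
    · rw [hD, Matrix.zero_mul, zero_add]
  have hone : A₀ 1 = 1 ∧ D₀ 1 = 1 := by
    have e1 := hM_one
    rw [hblock, ← Matrix.fromBlocks_one] at e1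
    obtain ⟨hA, -, -, hD⟩ := Matrix.fromBlocks_inj.mp e1
    exact ⟨hA, hD⟩
  -- as homomorphisms into `GL`
  let A : G →* GL (Fin m) K :=
    { toFun := fun g ↦ ⟨A₀ g, A₀ g⁻¹, by rw [← (hmul _ _).1, mul_inv_cancel, hone.1],
        by rw [← (hmul _ _).1, inv_mul_cancel, hone.1]⟩
      map_one' := Units.ext hone.1
      map_mul' := fun g h ↦ Units.ext (hmul g h).1 }
  let D : G →* GL (Fin p) K :=
    { toFun := fun g ↦ ⟨D₀ g, D₀ g⁻¹, by rw [← (hmul _ _).2, mul_inv_cancel, hone.2],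
        by rw [← (hmul _ _).2, inv_mul_cancel, hone.2]⟩
      map_one' := Units.ext hone.2
      map_mul' := fun g h ↦ Units.ext (hmul g h).2 }
  -- the change of basis: columns of `w` are the vectors `b (e⁻¹ i)`
  let s : Basis (Fin n) K (Fin n → K) := Pi.basisFun K (Fin n)
  let b' : Basis (Fin n) K (Fin n → K) := b.reindex e
  let w : GL (Fin n) K :=
    ⟨s.toMatrix b', b'.toMatrix s, s.toMatrix_mul_toMatrix_flip b', b'.toMatrix_mul_toMatrix_flip s⟩
  refine ⟨w, A, D, B₀, fun g ↦ ?_⟩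
  have hψg : ((ψ g : GL (Fin n) K) : Matrix (Fin n) (Fin n) K) = LinearMap.toMatrix s s
      (((Representation.ofDistribMulAction K (GL (Fin n) K) (Fin n → K)).comp ψ) g) := by
    simp only [s]
    rw [LinearMap.toMatrix_eq_toMatrix', hRlin, LinearMap.toMatrix'_toLin']
  have hb' : LinearMap.toMatrix b' b'
      (((Representation.ofDistribMulAction K (GL (Fin n) K) (Fin n → K)).comp ψ) g) =
      Matrix.reindex e e (M g) := by
    ext i j
    simp only [b', M, LinearMap.toMatrix_apply, Module.Basis.reindex_apply,
      Module.Basis.repr_reindex_apply, Matrix.reindex_apply, Matrix.submatrix_apply]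
  calc ((w⁻¹ * ψ g * w : GL (Fin n) K) : Matrix (Fin n) (Fin n) K)
      = b'.toMatrix s * LinearMap.toMatrix s s
          (((Representation.ofDistribMulAction K (GL (Fin n) K) (Fin n → K)).comp ψ) g) *
          s.toMatrix b' := by
        rw [Units.val_mul, Units.val_mul, hψg]; rfl
    _ = LinearMap.toMatrix b' b'
          (((Representation.ofDistribMulAction K (GL (Fin n) K) (Fin n → K)).comp ψ) g) :=
        basis_toMatrix_mul_linearMap_toMatrix_mul_basis_toMatrix b' s b' s _
    _ = Matrix.reindex e e (M g) := hb'
    _ = _ := by rw [hblock]; rfl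

end Helpers

/-- **Registered sub-goal `stub_residualNoCharacter` (no character inside `σ ⊕ σ'`)**: for `σ, σ'` irreducible
of rank `2` no pair `χ : G → GL₁(K)`, `D : G → GL₃(K)` has `det(X - χ g) det(X - D g) = det(X - σ g) det(X - σ' g)`
(`false_of_charpoly_fin_one_mul` in universe `0`; the shape excluded twice in `stub_residualTriangular`). [folklore] -/
theorem stub_residualNoCharacter :
    ∀ (K : Type) [Field K] (G : Type) [Group G] (σ σ' : G →* GL (Fin 2) K) (χ : G →* GL (Fin 1) K)
      (D : G →* GL (Fin 3) K),
      Representation.IsIrreducible ((Representation.ofDistribMulAction K (GL (Fin 2) K) (Fin 2 → K)).comp σ) →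
      Representation.IsIrreducible ((Representation.ofDistribMulAction K (GL (Fin 2) K) (Fin 2 → K)).comp σ') →
      (∀ g, (χ g).val.charpoly * (D g).val.charpoly = (σ g).val.charpoly * (σ' g).val.charpoly) → False :=
  fun _ _ _ _ _ _ χ D hσ hσ' h ↦ false_of_charpoly_fin_one_mul hσ hσ' χ D h

end Summit.Langlands.Langlands.Cruxes.ResiduallyYoshidaLifting.EndoscopicCrossingEuler

end
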